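import Summits.NavierStokesRegularity.FunctionalMining.NoGo.TopBotEigSplitWallCriterion
import Summits.NavierStokesRegularity.FunctionalMining.NoGo.TopBotEigSplitShareWallLine
import HarnessLib

/-!
# K19 — the wall criterion in ONE-DIMENSIONAL closed form: (N⁺) ∧ (D) ∧ (W) on `[1/3, 2/3]` ⟹ `TopBotEigSplitting q c`

search for candidate a priori estimates; no regularity claim.

No-go branch (door D-K6 (c), the share window of the symmetrised top–bottom density), kernel side,
every real `q ≥ 1`. K18 (`NoGo/TopBotEigSplitWallCriterion`) reduced `TopBotEigSplitting q c` to three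
typed hypotheses on the wall defect `F_{q,c}(a,b) = a^q + b^q − c·(2(a² − ab + b²))^{q/2}` (`wallF`):
(N) `F ≥ 0` on the segment, (M) `F` monotone on the eigen-sector (a TWO-dimensional two-point
statement), (C) `u ↦ F(u, 1 − u)^{1/q}` convex on `[1/3, 2/3]` (a convexity statement). This file
discharges (M) and (C) from SIGN CONDITIONS OF EXPLICIT ONE-VARIABLE CLOSED FORMS on `[1/3, 2/3]`,
written with K16's line functions (`NoGo/TopBotEigSplitShareWallLine`: `lineNsq u = 6u² − 6u + 2`,
`lineN`, `lineN1`, `lineN2`, `lineT = q·N·N″ − (q − 1)·N′²`):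

* (N⁺) `0 < lineN q c u` on `[1/3, 2/3]` (`lineN q c u = wallF q c u (1 − u)`, `wallF_line`);
* (D)  `c·(3u − 1)·(6u² − 6u + 2)^{q/2 − 1} ≤ u^{q − 1}` on `[1/3, 2/3]` — the sign of the partial
  derivative `∂_a F` on the segment (`wallFa`), which by `(q − 1)`-homogeneity and the symmetry
  `F(a,b) = F(b,a)` gives `∇F ≥ 0` on the whole eigen-sector, hence (M) by the mean-value theorem along
  segments of the (convex) sector (Mathlib `monotoneOn_of_deriv_nonneg`);
* (W)  `0 ≤ lineT q c u` on `(1/3, 2/3)` — with (N⁺) this is `ψ″ ≥ 0` for `ψ = N^{1/q}`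
  (`ψ″ = q⁻²·N^{1/q − 2}·T`), hence (C) by the second-derivative test (Mathlib `convexOn_of_deriv2_nonneg`;
  K16 used the same closed forms in the converse direction for the necessity `c ≤ c_axi(q)`).

So, for every real `q ≥ 1` and `c ≥ 0`:

  `topBotEigSplitting_of_line : (N⁺) → (D) → (W) → TopBotEigSplitting q c`,

three sign conditions of explicit functions of ONE real variable on `[1/3, 2/3]`, per `q`. With K16
(necessity `c ≤ c_axi(q)`), the dictionary's pen statement «`c_axi(q)` is attained» for a given `q` is
implied by (N⁺) ∧ (D) ∧ (W) at `c = cAxi q` — NOT discharged here for any `q` (K17 is the discharge at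
`q = 4`); in particular nothing is claimed for `1 < q < 2`, where K16's ceiling is a necessary bound only.

## Main statements (namespace `Summit.NavierStokesRegularity.FunctionalMining.TopEig`)

* `wallF_line : wallF q c u (1 - u) = lineN q c u`;
* `convexOn_wallPsi_of_lineT (hq : 1 ≤ q) (hN : (N⁺)) (hT : (W)) : ConvexOn ℝ (Icc (1/3) (2/3)) (wallPsi q c)`;
* `wallFa`, `hasDerivAt_wallF_segment`, `wallFa_sector_nonneg`, `wallF_mono_of_lineD` ((D) ⟹ (M));
* `topBotEigSplitting_of_line (hq : 1 ≤ q) (hc : 0 ≤ c) (hN) (hD) (hT) : TopBotEigSplitting q c`;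
* §5 consistency at `q = 4`, `c = 2/9`: `lineN_four`, `lineN1_four`, `lineN2_four`, `lineT_four` (K17's wall
  identity), `lineD_four`, and — as a kernel-checked `example`, not a declaration (the statement
  `TopBotEigSplitting 4 (2/9)` is K17's `topBotEigSplitting_four_sharp` by name) — K17's theorem re-derived
  END-TO-END through the one-dimensional criterion (the three hypotheses are satisfiable and correctly oriented).

HONEST FRAMING. A finite-dimensional statement about convex functions on flat `3 × 3` tensors and
one-variable calculus; nothing about Navier–Stokes is proved or asserted; no `heatDissipation`
statement; no regularity claim.

Tree / staged results used, by name: K18 (`wallF`, `wallG`, `wallPsi`, `wallF_zero`, `wallF_sector_nonneg`,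
`two_mul_quad_nonneg`, `topBotEigSplitting_of_wall`), K16 part 1 (`lineNsq`, `lineNsq_pos`, `lineN`,
`lineN1`, `lineN2`, `lineT`, `hasDerivAt_lineN`, `hasDerivAt_lineN1`), K17 (`segN`, `segN1`, `segN2`,
`hasDerivAt_segN`, `hasDerivAt_segN1`, `segN_pos`, `segN_wall_nonneg`; K18 `wallF_four`); Mathlib
`HasDerivAt.rpow_const`, `Real.mul_rpow`, `Real.rpow_mul`, `Real.rpow_add_one`, `Real.rpow_sub_one`,
`monotoneOn_of_deriv_nonneg`, `convexOn_of_deriv2_nonneg`, `interior_Icc`. [ours] = this programme's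
own elementary work.
v2 = v1 47524dbe63b287a5 with (i) the bookkeeping lemma RENAMED `sq_rpow_half_sub_one` → `sq_rpow_half_sub_one_real` (the fq name
`TopEig.sq_rpow_half_sub_one` is taken in the tree by the `Tens3` form of `NoGo.TopBotEigSplitFloorLeTwo`, outside this file's imports;
census-2 (dd.347)) and (ii) `topBotEigSplitting_four_sharp_of_line` DEMOTED to an `example` (its type is verbatim K17's
`topBotEigSplitting_four_sharp` — census-1 (cc.265) T3b); every statement kept is unchanged.
FILING (prove seat g28, REQUEST #34): declarations byte-identical to the no-go seat's staged `TopBotEigSplitWallOneDim.STAGING.lean` bfeee6c90141296c; this line is the only addition.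
-/

noncomputable section

open Set Real

namespace Summit.NavierStokesRegularity.FunctionalMining

namespace TopEig

/-! ## 1. The segment: `F_{q,c}(u, 1 − u)` is K16's `lineN q c u` -/

/-- `2(u² − u(1 − u) + (1 − u)²) = 6u² − 6u + 2`. [bookkeeping] -/
theorem two_mul_quad_line (u : ℝ) : 2 * (u ^ 2 - u * (1 - u) + (1 - u) ^ 2) = lineNsq u := by
  unfold lineNsq; ring

/-- **`F_{q,c}(u, 1 − u) = N(u)`** (K16's line function). [bookkeeping] -/
theorem wallF_line (q c u : ℝ) : wallF q c u (1 - u) = lineN q c u := by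
  unfold wallF lineN; rw [two_mul_quad_line]

/-- `ψ_{q,c} = N^{1/q}` as functions. [bookkeeping] -/
theorem wallPsi_eq (q c : ℝ) : wallPsi q c = fun u => lineN q c u ^ q⁻¹ := by
  funext u; simp only [wallPsi, wallG, wallF_line]

/-! ## 2. (W) ∧ (N⁺) ⟹ (C): the second-derivative test for `ψ = N^{1/q}` -/

/-- `ψ′` in closed form on `(1/3, 2/3)`. [ours] -/
def linePsi1 (q c u : ℝ) : ℝ := lineN1 q c u * q⁻¹ * lineN q c u ^ (q⁻¹ - 1)

/-- `ψ″` in closed form on `(1/3, 2/3)`. [ours] -/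
def linePsi2 (q c u : ℝ) : ℝ :=
  lineN2 q c u * q⁻¹ * lineN q c u ^ (q⁻¹ - 1) +
    lineN1 q c u * q⁻¹ * (lineN1 q c u * (q⁻¹ - 1) * lineN q c u ^ (q⁻¹ - 1 - 1))

section convexity

variable {q c : ℝ} (hq : 1 ≤ q)
  (hN : ∀ ⦃u : ℝ⦄, 1 / 3 ≤ u → u ≤ 2 / 3 → 0 < lineN q c u)
  (hT : ∀ ⦃u : ℝ⦄, 1 / 3 < u → u < 2 / 3 → 0 ≤ lineT q c u)

include hN in
/-- `ψ' = linePsi1` on `(1/3, 2/3)` (needs (N⁺)). [bookkeeping] -/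
theorem hasDerivAt_wallPsi {u : ℝ} (hu : u ∈ Ioo (1 / 3 : ℝ) (2 / 3)) :
    HasDerivAt (wallPsi q c) (linePsi1 q c u) u := by
  have hNu := hN hu.1.le hu.2.le
  rw [wallPsi_eq]
  exact (hasDerivAt_lineN q c (by linarith [hu.1]) (by linarith [hu.2])).rpow_const (Or.inl hNu.ne')

include hN in
/-- `linePsi1' = linePsi2` on `(1/3, 2/3)`. [bookkeeping] -/
theorem hasDerivAt_linePsi1 {u : ℝ} (hu : u ∈ Ioo (1 / 3 : ℝ) (2 / 3)) :
    HasDerivAt (linePsi1 q c) (linePsi2 q c u) u := by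
  have hNu := hN hu.1.le hu.2.le
  have hu0 : 0 < u := by linarith [hu.1]
  have hu1 : u < 1 := by linarith [hu.2]
  have h1 : HasDerivAt (fun y => lineN q c y ^ (q⁻¹ - 1))
      (lineN1 q c u * (q⁻¹ - 1) * lineN q c u ^ (q⁻¹ - 1 - 1)) u :=
    (hasDerivAt_lineN q c hu0 hu1).rpow_const (Or.inl hNu.ne')
  have h2 : HasDerivAt (fun y => lineN1 q c y * q⁻¹) (lineN2 q c u * q⁻¹) u :=
    (hasDerivAt_lineN1 q c hu0 hu1).mul_const _
  exact h2.mul h1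

include hN in
/-- `deriv ψ = linePsi1` on `(1/3, 2/3)`. [bookkeeping] -/
theorem deriv_wallPsi_eqOn : EqOn (deriv (wallPsi q c)) (linePsi1 q c) (Ioo (1 / 3 : ℝ) (2 / 3)) :=
  fun _ hu => (hasDerivAt_wallPsi hN hu).deriv

include hN in
/-- `(deriv ψ)' = linePsi2` on `(1/3, 2/3)`. [bookkeeping] -/
theorem hasDerivAt_deriv_wallPsi {u : ℝ} (hu : u ∈ Ioo (1 / 3 : ℝ) (2 / 3)) :
    HasDerivAt (deriv (wallPsi q c)) (linePsi2 q c u) u :=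
  (hasDerivAt_linePsi1 hN hu).congr_of_eventuallyEq
    (Filter.eventuallyEq_of_mem (Ioo_mem_nhds hu.1 hu.2) (deriv_wallPsi_eqOn hN))

include hq hN hT in
/-- `ψ″ = q⁻²·N^{1/q − 2}·T ≥ 0` on `(1/3, 2/3)`. [ours] -/
theorem linePsi2_nonneg {u : ℝ} (hu : u ∈ Ioo (1 / 3 : ℝ) (2 / 3)) : 0 ≤ linePsi2 q c u := by
  have hNu := hN hu.1.le hu.2.le
  have hq0 : q ≠ 0 := by linarith
  have hqi : 0 ≤ q⁻¹ := inv_nonneg.mpr (by linarith)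
  have hpow : lineN q c u ^ (q⁻¹ - 1) = lineN q c u ^ (q⁻¹ - 1 - 1) * lineN q c u := by
    rw [rpow_sub_one hNu.ne' (q⁻¹ - 1)]; field_simp
  have e : linePsi2 q c u = q⁻¹ * q⁻¹ * lineN q c u ^ (q⁻¹ - 1 - 1) * lineT q c u := by
    unfold linePsi2 lineT; rw [hpow]
    linear_combination (-(q⁻¹ * lineN q c u ^ (q⁻¹ - 1 - 1) * lineN q c u * lineN2 q c u -
      q⁻¹ * lineN q c u ^ (q⁻¹ - 1 - 1) * lineN1 q c u ^ 2)) * mul_inv_cancel₀ hq0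
  rw [e]
  exact mul_nonneg (mul_nonneg (mul_nonneg hqi hqi) (rpow_nonneg hNu.le _)) (hT hu.1 hu.2)

include hq hN hT in
/-- **(W) ∧ (N⁺) ⟹ (C): `ψ = N^{1/q}` is convex on `[1/3, 2/3]`.** [ours; Mathlib `convexOn_of_deriv2_nonneg`] -/
theorem convexOn_wallPsi_of_lineT : ConvexOn ℝ (Icc (1 / 3 : ℝ) (2 / 3)) (wallPsi q c) := by
  have hint : interior (Icc (1 / 3 : ℝ) (2 / 3)) = Ioo (1 / 3) (2 / 3) := interior_Icc
  have hq0 : 0 ≤ q⁻¹ := inv_nonneg.mpr (by linarith)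
  refine convexOn_of_deriv2_nonneg (convex_Icc _ _) ?_ ?_ ?_ ?_
  · rw [wallPsi_eq]
    intro x hx
    have hx0 : 0 < x := by linarith [hx.1]
    have hx1 : x < 1 := by linarith [hx.2]
    exact ((hasDerivAt_lineN q c hx0 hx1).continuousAt.rpow_const (Or.inr hq0)).continuousWithinAt
  · rw [hint]; intro x hx
    exact (hasDerivAt_wallPsi hN hx).differentiableAt.differentiableWithinAt
  · rw [hint]; intro x hx
    exact (hasDerivAt_deriv_wallPsi hN hx).differentiableAt.differentiableWithinAt
  · rw [hint]; intro x hx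
    rw [Function.iterate_succ_apply', Function.iterate_one, (hasDerivAt_deriv_wallPsi hN hx).deriv]
    exact linePsi2_nonneg hq hN hT hx

end convexity

/-! ## 3. (D) ⟹ (M): the gradient of `F` on the eigen-sector and the mean-value theorem -/

/-- **`∂_a F_{q,c}` in closed form**: `q·a^{q−1} − c·q·(2a − b)·(2(a² − ab + b²))^{q/2 − 1}`
(and `∂_b F(a, b) = wallFa q c b a` by the symmetry of `F`). [ours] -/
def wallFa (q c a b : ℝ) : ℝ :=
  q * a ^ (q - 1) - c * (q * (2 * a - b)) * (2 * (a ^ 2 - a * b + b ^ 2)) ^ (q / 2 - 1)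

/-- `(t²)^{q/2 − 1} = t^{q − 2}` for `t ≥ 0` (real-variable form; the tree's `TopEig.sq_rpow_half_sub_one` in
`NoGo.TopBotEigSplitFloorLeTwo` is the `Tens3`-norm form — hence the distinct name). [bookkeeping] -/
theorem sq_rpow_half_sub_one_real {t : ℝ} (ht : 0 ≤ t) (q : ℝ) : (t ^ 2) ^ (q / 2 - 1) = t ^ (q - 2) := by
  rw [← Real.rpow_natCast, ← Real.rpow_mul ht]; congr 1; push_cast; ring

/-- `∂_a F` is `(q − 1)`-homogeneous (for `t > 0`). [ours] -/
theorem wallFa_smul (q c : ℝ) {t a b : ℝ} (ht : 0 < t) (ha : 0 ≤ a) :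
    wallFa q c (t * a) (t * b) = t ^ (q - 1) * wallFa q c a b := by
  unfold wallFa
  have e1 : 2 * ((t * a) ^ 2 - t * a * (t * b) + (t * b) ^ 2) =
      t ^ 2 * (2 * (a ^ 2 - a * b + b ^ 2)) := by ring
  have e2 : t ^ (q - 1) = t ^ (q - 2) * t := by
    rw [← Real.rpow_add_one ht.ne']; congr 1; ring
  rw [mul_rpow ht.le ha, e1, mul_rpow (pow_nonneg ht.le 2) (two_mul_quad_nonneg a b),
    sq_rpow_half_sub_one_real ht.le, e2]
  ring

/-- On the segment: `∂_a F(u, 1 − u) = q·(u^{q−1} − c(3u − 1)(6u² − 6u + 2)^{q/2 − 1})`. [ours] -/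
theorem wallFa_line (q c u : ℝ) :
    wallFa q c u (1 - u) = q * (u ^ (q - 1) - c * (3 * u - 1) * lineNsq u ^ (q / 2 - 1)) := by
  unfold wallFa; rw [two_mul_quad_line]; ring

/-- **(D) ⟹ `∂_a F ≥ 0` on the eigen-sector** (homogeneity to the segment `a + b = 1`). [ours] -/
theorem wallFa_sector_nonneg {q c : ℝ} (hq : 1 ≤ q)
    (hD : ∀ ⦃u : ℝ⦄, 1 / 3 ≤ u → u ≤ 2 / 3 → c * (3 * u - 1) * lineNsq u ^ (q / 2 - 1) ≤ u ^ (q - 1))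
    {a b : ℝ} (ha : 0 ≤ a) (hb2 : b ≤ 2 * a) (ha2 : a ≤ 2 * b) (hs : 0 < a + b) :
    0 ≤ wallFa q c a b := by
  obtain ⟨hu1, hu2⟩ := sector_ratio_mem hb2 ha2 hs
  have ea : (a + b) * (a / (a + b)) = a := by field_simp
  have eb : (a + b) * (1 - a / (a + b)) = b := by field_simp; ring
  have key : wallFa q c a b = (a + b) ^ (q - 1) * wallFa q c (a / (a + b)) (1 - a / (a + b)) := by
    rw [← wallFa_smul q c hs (div_nonneg ha hs.le), ea, eb]
  rw [key, wallFa_line]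
  refine mul_nonneg (rpow_nonneg hs.le _) (mul_nonneg (by linarith) ?_)
  linarith [hD hu1 hu2]

/-- **The derivative of `F` along a segment**: `d/dt F(a + t·da, b + t·db) = da·∂_aF + db·∂_bF` at any
`t` with `(a + t·da) + (b + t·db) > 0` (`q ≥ 1`). [ours] -/
theorem hasDerivAt_wallF_segment {q : ℝ} (hq : 1 ≤ q) (c a b da db : ℝ) {t : ℝ}
    (hpos : 0 < (a + t * da) + (b + t * db)) :
    HasDerivAt (fun s => wallF q c (a + s * da) (b + s * db))
      (da * wallFa q c (a + t * da) (b + t * db) + db * wallFa q c (b + t * db) (a + t * da)) t := by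
  have hXd : HasDerivAt (fun s : ℝ => a + s * da) da t := by
    simpa using ((hasDerivAt_id' t).mul_const da).const_add a
  have hYd : HasDerivAt (fun s : ℝ => b + s * db) db t := by
    simpa using ((hasDerivAt_id' t).mul_const db).const_add b
  have hB : 0 < 2 * ((a + t * da) ^ 2 - (a + t * da) * (b + t * db) + (b + t * db) ^ 2) := by
    nlinarith [sq_nonneg ((a + t * da) - (b + t * db)), sq_nonneg ((a + t * da) + (b + t * db))]
  have h1 : HasDerivAt (fun s : ℝ => (a + s * da) ^ q) (da * q * (a + t * da) ^ (q - 1)) t :=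
    hXd.rpow_const (Or.inr hq)
  have h2 : HasDerivAt (fun s : ℝ => (b + s * db) ^ q) (db * q * (b + t * db) ^ (q - 1)) t :=
    hYd.rpow_const (Or.inr hq)
  have hBd : HasDerivAt
      (fun s : ℝ => 2 * ((a + s * da) ^ 2 - (a + s * da) * (b + s * db) + (b + s * db) ^ 2))
      (2 * ((2 * (a + t * da) - (b + t * db)) * da + (2 * (b + t * db) - (a + t * da)) * db)) t :=
    ((((hXd.pow 2).sub (hXd.mul hYd)).add (hYd.pow 2)).const_mul 2).congr_deriv (by norm_num; ring)
  have h3 := hBd.rpow_const (p := q / 2) (Or.inl hB.ne')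
  have h := (h1.add h2).sub (h3.const_mul c)
  show HasDerivAt (fun s => (a + s * da) ^ q + (b + s * db) ^ q -
      c * (2 * ((a + s * da) ^ 2 - (a + s * da) * (b + s * db) + (b + s * db) ^ 2)) ^ (q / 2)) _ t
  refine h.congr_deriv ?_
  have eY : 2 * ((b + t * db) ^ 2 - (b + t * db) * (a + t * da) + (a + t * da) ^ 2) =
      2 * ((a + t * da) ^ 2 - (a + t * da) * (b + t * db) + (b + t * db) ^ 2) := by ring
  unfold wallFa; rw [eY]; ring

/-- **(D) ⟹ (M): `F` is non-decreasing on the eigen-sector** (mean-value theorem along the segment,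
which stays in the convex sector; the origin case by (N)). [ours; Mathlib `monotoneOn_of_deriv_nonneg`] -/
theorem wallF_mono_of_lineD {q c : ℝ} (hq : 1 ≤ q)
    (hN : ∀ ⦃u : ℝ⦄, 1 / 3 ≤ u → u ≤ 2 / 3 → 0 ≤ wallF q c u (1 - u))
    (hD : ∀ ⦃u : ℝ⦄, 1 / 3 ≤ u → u ≤ 2 / 3 → c * (3 * u - 1) * lineNsq u ^ (q / 2 - 1) ≤ u ^ (q - 1))
    ⦃a b a' b' : ℝ⦄ (ha : 0 ≤ a) (hb : 0 ≤ b) (hb2 : b ≤ 2 * a) (ha2 : a ≤ 2 * b) (hb2' : b' ≤ 2 * a')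
    (ha2' : a' ≤ 2 * b') (haa : a ≤ a') (hbb : b ≤ b') : wallF q c a b ≤ wallF q c a' b' := by
  rcases (add_nonneg ha hb).eq_or_lt with hs | hs
  · have h0 : a = 0 ∧ b = 0 := ⟨by linarith, by linarith⟩
    rw [h0.1, h0.2, wallF_zero (by linarith) c]
    exact wallF_sector_nonneg hq hN (by linarith) (by linarith) hb2' ha2'
  -- the segment `t ↦ (a + t(a' − a), b + t(b' − b))`, `t ∈ [0, 1]`, stays in the sector, away from 0
  have seg : ∀ ⦃t : ℝ⦄, 0 ≤ t → t ≤ 1 →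
      0 ≤ a + t * (a' - a) ∧ 0 ≤ b + t * (b' - b) ∧
      b + t * (b' - b) ≤ 2 * (a + t * (a' - a)) ∧ a + t * (a' - a) ≤ 2 * (b + t * (b' - b)) ∧
      0 < (a + t * (a' - a)) + (b + t * (b' - b)) := by
    intro t ht0 ht1
    refine ⟨by nlinarith, by nlinarith, by nlinarith, by nlinarith, by nlinarith⟩
  have hder : ∀ ⦃t : ℝ⦄, 0 ≤ t → t ≤ 1 →
      HasDerivAt (fun s => wallF q c (a + s * (a' - a)) (b + s * (b' - b)))
        ((a' - a) * wallFa q c (a + t * (a' - a)) (b + t * (b' - b)) +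
          (b' - b) * wallFa q c (b + t * (b' - b)) (a + t * (a' - a))) t :=
    fun t ht0 ht1 => hasDerivAt_wallF_segment hq c a b (a' - a) (b' - b) (seg ht0 ht1).2.2.2.2
  have hmono : MonotoneOn (fun s => wallF q c (a + s * (a' - a)) (b + s * (b' - b))) (Icc (0 : ℝ) 1) := by
    refine monotoneOn_of_deriv_nonneg (convex_Icc 0 1) ?_ ?_ ?_
    · exact fun t ht => (hder ht.1 ht.2).continuousAt.continuousWithinAt
    · intro t ht
      have ht' : t ∈ Icc (0 : ℝ) 1 := interior_subset ht
      exact (hder ht'.1 ht'.2).differentiableAt.differentiableWithinAt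
    · intro t ht
      have ht' : t ∈ Icc (0 : ℝ) 1 := interior_subset ht
      obtain ⟨hX, hY, hYX, hXY, hS⟩ := seg ht'.1 ht'.2
      rw [(hder ht'.1 ht'.2).deriv]
      have h1 := wallFa_sector_nonneg hq hD hX hYX hXY hS
      have h2 := wallFa_sector_nonneg hq hD hY hXY hYX (by linarith)
      have h3 : 0 ≤ a' - a := by linarith
      have h4 : 0 ≤ b' - b := by linarith
      positivity
  have h := hmono ⟨le_refl 0, zero_le_one⟩ ⟨zero_le_one, le_refl 1⟩ zero_le_one
  simpa using h

/-! ## 4. The one-dimensional criterion -/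

/-- **K19 — the wall criterion in one-dimensional closed form.** For real `q ≥ 1`, `c ≥ 0`:
(N⁺) `0 < N` on `[1/3, 2/3]`, (D) `c(3u − 1)(6u² − 6u + 2)^{q/2−1} ≤ u^{q−1}` on `[1/3, 2/3]` and
(W) `0 ≤ T = qNN″ − (q−1)N′²` on `(1/3, 2/3)` imply `TopBotEigSplitting q c` (witness as in K18:
`M = 2^q`, `h = wallGauge q c`). [ours] -/
theorem topBotEigSplitting_of_line {q c : ℝ} (hq : 1 ≤ q) (hc : 0 ≤ c)
    (hN : ∀ ⦃u : ℝ⦄, 1 / 3 ≤ u → u ≤ 2 / 3 → 0 < lineN q c u)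
    (hD : ∀ ⦃u : ℝ⦄, 1 / 3 ≤ u → u ≤ 2 / 3 → c * (3 * u - 1) * lineNsq u ^ (q / 2 - 1) ≤ u ^ (q - 1))
    (hT : ∀ ⦃u : ℝ⦄, 1 / 3 < u → u < 2 / 3 → 0 ≤ lineT q c u) : TopBotEigSplitting q c := by
  have hN' : ∀ ⦃u : ℝ⦄, 1 / 3 ≤ u → u ≤ 2 / 3 → 0 ≤ wallF q c u (1 - u) := fun u h1 h2 => by
    rw [wallF_line]; exact (hN h1 h2).le
  exact topBotEigSplitting_of_wall hq hc hN' (wallF_mono_of_lineD hq hN' hD)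
    (convexOn_wallPsi_of_lineT hq hN hT)

/-! ## 5. Consistency at `q = 4`: K17's sharp share through the one-dimensional criterion -/

section four

/-- `lineN 4 (2/9) = segN` (K17's segment restriction `quartF u (1 − u)`). [bookkeeping] -/
theorem lineN_four (u : ℝ) : lineN 4 (2 / 9) u = segN u := by
  rw [← wallF_line, wallF_four]; rfl

/-- `lineN1 4 (2/9) = segN1` on `(0, 1)` (uniqueness of the derivative). [bookkeeping] -/
theorem lineN1_four {u : ℝ} (hu0 : 0 < u) (hu1 : u < 1) : lineN1 4 (2 / 9) u = segN1 u := by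
  have hf : lineN 4 (2 / 9) = segN := funext lineN_four
  have h := hasDerivAt_lineN 4 (2 / 9) hu0 hu1
  rw [hf] at h
  exact h.unique (hasDerivAt_segN u)

/-- `lineN2 4 (2/9) = segN2` on `(0, 1)`. [bookkeeping] -/
theorem lineN2_four {u : ℝ} (hu0 : 0 < u) (hu1 : u < 1) : lineN2 4 (2 / 9) u = segN2 u := by
  have h : HasDerivAt segN1 (lineN2 4 (2 / 9) u) u :=
    (hasDerivAt_lineN1 4 (2 / 9) hu0 hu1).congr_of_eventuallyEq
      (Filter.eventuallyEq_of_mem (Ioo_mem_nhds hu0 hu1) fun x hx => (lineN1_four hx.1 hx.2).symm)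
  exact h.unique (hasDerivAt_segN1 u)

/-- (W) at `q = 4`, `c = 2/9` is K17's wall expression `4NN″ − 3N′²`. [bookkeeping] -/
theorem lineT_four {u : ℝ} (hu0 : 0 < u) (hu1 : u < 1) :
    lineT 4 (2 / 9) u = 4 * segN u * segN2 u - 3 * segN1 u ^ 2 := by
  unfold lineT; rw [lineN_four, lineN1_four hu0 hu1, lineN2_four hu0 hu1]; norm_num

/-- (D) at `q = 4`, `c = 2/9`: `(2/9)(3u − 1)(6u² − 6u + 2) ≤ u³` on `[1/3, 2/3]`. [ours] -/
theorem lineD_four {u : ℝ} (hu1 : 1 / 3 ≤ u) (hu2 : u ≤ 2 / 3) :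
    2 / 9 * (3 * u - 1) * lineNsq u ^ ((4 : ℝ) / 2 - 1) ≤ u ^ ((4 : ℝ) - 1) := by
  unfold lineNsq; norm_num
  have h1 : 0 ≤ 3 * u - 1 := by linarith
  have h2 : 0 ≤ 2 - 3 * u := by linarith
  nlinarith [mul_nonneg h1 h2, mul_nonneg (mul_nonneg h1 h2) h1, mul_nonneg (mul_nonneg h1 h2) h2,
    sq_nonneg (u - 1 / 2)]

/- **K17 through K19** (a kernel-checked `example`, v2; the statement is K17's `topBotEigSplitting_four_sharp`
by name): `TopBotEigSplitting 4 (2/9)` from the one-dimensional criterion — (N⁺) is K17's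
`segN_pos`, (D) is `lineD_four`, (W) is K17's wall identity `segN_wall_nonneg`. [ours] -/
example : TopBotEigSplitting 4 (2 / 9) :=
  topBotEigSplitting_of_line (by norm_num) (by norm_num)
    (fun u hu1 hu2 => by rw [lineN_four]; exact segN_pos hu1 hu2)
    (fun u hu1 hu2 => lineD_four hu1 hu2)
    (fun u hu1 hu2 => by
      rw [lineT_four (by linarith) (by linarith)]; exact segN_wall_nonneg hu1.le hu2.le)

end four

end TopEig

end Summit.NavierStokesRegularity.FunctionalMining
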